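import Mathlib
import Summits.RiemannHypothesis.RiemannHypothesis.Theorems.WeilFarFloorResidualDirectionTools
import Summits.RiemannHypothesis.RiemannHypothesis.Theorems.WeilFarFloorSmoothedResidual
import Summits.RiemannHypothesis.RiemannHypothesis.Theorems.WeilFarFloorSecondOrderLowerCoreRH
import HarnessLib

/-!
# The smoothed residual as a test direction: the budgets of the second-order lower bound (RH-free)

Helper file (`--supports stmt-RiemannHypothesis-0098`, lead-track anchor: Weil-positivity window ladder, format-C far bound),
pure proofs, no `RiemannHypothesis` anywhere.  Seat rh-explicit-weil-1 gen15 (memo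
`run/shared/lean/pub/rh-explicit/rh-explicit-weil-1/FORMAT-K3.md` §16.4).

`C = C_a = 1_{[−a,a]}cosh(·/2)`, `F = T_aC`, `P = a + sinh a`, `R = Q_a(C)/P`, `G = F − RC`, `ρ = ∫_{(−a,a)} G²`, `W ≥ Σ 2Λ(n)/√n`,
`X = e^a`.  For the smoothed truncated residual `v = bump_σ ⋆ box_σ ⋆ 1_{[−(a−2σ), a−2σ]}G` of `WeilFarFloorSmoothedResidual`:

★ `exists_residualDirection` (tools in `WeilFarFloorResidualDirectionTools`): the window identities `∫_{(−a,a)} CG = 0`,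
`∫_{(−a,a)} FG = ρ` and the collar of width `4σ` give the budgets of
`WeilFarFloorSecondOrderLowerCoreRH.farCoercivityFloor_sub_coshQuotient_ge_of_direction`:
  `∫v² ≤ ρ`, `|∫Cv| ≤ 8WXσ + (θP + 224W²Xσ/θ)/2`, `|∫Fv − ρ| ≤ 8W²Xσ + (θ'W²P + 224W²Xσ/θ')/2`,
  `|∫v sinh(·/2)| ≤ (θP + 224W²Xσ/θ)/2`, the quadratic moduli `D_h(v) ≤ (ρ/σ²)h²`, `D_h(xv) ≤ (2(a+1)²ρ/σ² + 2ρ)h²`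
  (`0 < h ≤ min(2σ, 1)`), and `∫x²v² ≤ a²∫v²` — for all `θ, θ' > 0`, `0 < σ ≤ 1/4`, `a ≥ 1`.
Standard axioms only.
-/

set_option linter.dupNamespace false
set_option autoImplicit false

noncomputable section

open MeasureTheory Set Filter
open scoped Real Topology ArithmeticFunction.vonMangoldt

namespace Summit.RiemannHypothesis.RiemannHypothesis.Theorems.WeilFormatC

namespace FloorSecondOrder

open Literature.NumberTheory.LFunctions FloorCosh FloorCoshSplit

variable {a : ℝ}

/-! ## The residual direction and its budgets -/

/-- ★ **The smoothed residual as a test direction (RH-free).**  Let `a ≥ 1`, `Σ_{log n<2a} 2Λ(n)/√n ≤ W`,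
`R = Q_a(C_a)/(a + sinh a) ≥ 0`, `0 < σ ≤ 1/4`, `θ, θ' > 0`; write `P = a + sinh a`, `X = e^a`, `F = T_aC_a`,
`ρ = ∫_{(−a,a)}(F − RC_a)²`.  Then there is a real Weil test `v` supported in `[−a, a]` with `∫v² ≤ ρ`,
`|∫C_av| ≤ 8WXσ + (θP + 224W²Xσ/θ)/2`, `|∫Fv − ρ| ≤ 8W²Xσ + (θ'W²P + 224W²Xσ/θ')/2`, `|∫v sinh(·/2)| ≤ (θP + 224W²Xσ/θ)/2`,
the quadratic moduli `∫‖v(x+h) − v(x)‖² ≤ (ρ/σ²)h²`, `∫‖(x+h)v(x+h) − xv(x)‖² ≤ (2(a+1)²ρ/σ² + 2ρ)h²` for `0 < h ≤ min(2σ, 1)`,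
and `∫x²v² ≤ a²∫v²` (the smoothed truncated residual of `WeilFarFloorSmoothedResidual`; window identities `∫_{(−a,a)}C_aG = 0`,
`∫_{(−a,a)}FG = ρ`, a collar of width `4σ`, and weighted AM–GM). -/
theorem exists_residualDirection (ha : 1 ≤ a) {W σ θ θ' : ℝ}
    (hW : ∑ n ∈ weilPrimeIndex a, 2 * ((Λ n : ℝ) / Real.sqrt n) ≤ W)
    (hR0 : 0 ≤ primeShiftForm a ((Icc (-a) a).indicator (fun y ↦ Real.cosh (y / 2))) / (a + Real.sinh a))
    (hσ : 0 < σ) (hσ1 : σ ≤ 1 / 4) (hθ : 0 < θ) (hθ' : 0 < θ') :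
    ∃ v : ℝ → ℝ, IsWeilTest (fun x ↦ (v x : ℂ)) ∧ tsupport (fun x ↦ (v x : ℂ)) ⊆ Icc (-a) a ∧
      (∫ x, v x ^ 2 ≤ ∫ x in Ioo (-a) a,
        ((∑ n ∈ weilPrimeIndex a, (Λ n : ℝ) / Real.sqrt n *
            ((Icc (-a) a).indicator (fun y ↦ Real.cosh (y / 2)) (x - Real.log n)
              + (Icc (-a) a).indicator (fun y ↦ Real.cosh (y / 2)) (x + Real.log n)))
          - primeShiftForm a ((Icc (-a) a).indicator (fun y ↦ Real.cosh (y / 2))) / (a + Real.sinh a)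
            * (Icc (-a) a).indicator (fun y ↦ Real.cosh (y / 2)) x) ^ 2) ∧
      (|∫ x, (Icc (-a) a).indicator (fun y ↦ Real.cosh (y / 2)) x * v x|
        ≤ 8 * W * Real.exp a * σ + (θ * (a + Real.sinh a) + 224 * W ^ 2 * Real.exp a * σ / θ) / 2) ∧
      (|(∫ x, (∑ n ∈ weilPrimeIndex a, (Λ n : ℝ) / Real.sqrt n *
          ((Icc (-a) a).indicator (fun y ↦ Real.cosh (y / 2)) (x - Real.log n)
            + (Icc (-a) a).indicator (fun y ↦ Real.cosh (y / 2)) (x + Real.log n))) * v x)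
          - ∫ x in Ioo (-a) a,
            ((∑ n ∈ weilPrimeIndex a, (Λ n : ℝ) / Real.sqrt n *
                ((Icc (-a) a).indicator (fun y ↦ Real.cosh (y / 2)) (x - Real.log n)
                  + (Icc (-a) a).indicator (fun y ↦ Real.cosh (y / 2)) (x + Real.log n)))
              - primeShiftForm a ((Icc (-a) a).indicator (fun y ↦ Real.cosh (y / 2))) / (a + Real.sinh a)
                * (Icc (-a) a).indicator (fun y ↦ Real.cosh (y / 2)) x) ^ 2|
        ≤ 8 * W ^ 2 * Real.exp a * σ
          + (θ' * (W ^ 2 * (a + Real.sinh a)) + 224 * W ^ 2 * Real.exp a * σ / θ') / 2) ∧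
      (|∫ t, v t * Real.sinh (t / 2)| ≤ (θ * (a + Real.sinh a) + 224 * W ^ 2 * Real.exp a * σ / θ) / 2) ∧
      (∀ h : ℝ, 0 < h → h ≤ min (2 * σ) 1 →
        ∫ x, ‖((v (x + h) : ℝ) : ℂ) - ((v x : ℝ) : ℂ)‖ ^ 2
          ≤ (∫ x in Ioo (-a) a,
              ((∑ n ∈ weilPrimeIndex a, (Λ n : ℝ) / Real.sqrt n *
                  ((Icc (-a) a).indicator (fun y ↦ Real.cosh (y / 2)) (x - Real.log n)
                    + (Icc (-a) a).indicator (fun y ↦ Real.cosh (y / 2)) (x + Real.log n)))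
                - primeShiftForm a ((Icc (-a) a).indicator (fun y ↦ Real.cosh (y / 2))) / (a + Real.sinh a)
                  * (Icc (-a) a).indicator (fun y ↦ Real.cosh (y / 2)) x) ^ 2) / σ ^ 2 * h ^ 2) ∧
      (∀ h : ℝ, 0 < h → h ≤ min (2 * σ) 1 →
        ∫ x, ‖((x + h : ℝ) : ℂ) * ((v (x + h) : ℝ) : ℂ) - (x : ℂ) * ((v x : ℝ) : ℂ)‖ ^ 2
          ≤ (2 * (a + 1) ^ 2 * ((∫ x in Ioo (-a) a,
              ((∑ n ∈ weilPrimeIndex a, (Λ n : ℝ) / Real.sqrt n *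
                  ((Icc (-a) a).indicator (fun y ↦ Real.cosh (y / 2)) (x - Real.log n)
                    + (Icc (-a) a).indicator (fun y ↦ Real.cosh (y / 2)) (x + Real.log n)))
                - primeShiftForm a ((Icc (-a) a).indicator (fun y ↦ Real.cosh (y / 2))) / (a + Real.sinh a)
                  * (Icc (-a) a).indicator (fun y ↦ Real.cosh (y / 2)) x) ^ 2) / σ ^ 2)
            + 2 * (∫ x in Ioo (-a) a,
              ((∑ n ∈ weilPrimeIndex a, (Λ n : ℝ) / Real.sqrt n *
                  ((Icc (-a) a).indicator (fun y ↦ Real.cosh (y / 2)) (x - Real.log n)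
                    + (Icc (-a) a).indicator (fun y ↦ Real.cosh (y / 2)) (x + Real.log n)))
                - primeShiftForm a ((Icc (-a) a).indicator (fun y ↦ Real.cosh (y / 2))) / (a + Real.sinh a)
                  * (Icc (-a) a).indicator (fun y ↦ Real.cosh (y / 2)) x) ^ 2)) * h ^ 2) ∧
      (∫ x, x ^ 2 * v x ^ 2 ≤ a ^ 2 * ∫ x, v x ^ 2) := by
  classical
  have ha0 : 0 < a := by linarith only [ha]
  obtain ⟨hCm, hCb, hCs⟩ := coshTest_admissible a
  have hP0' : 0 < a + Real.sinh a := by have := Real.sinh_pos_iff.2 ha0; linarith only [this, ha0]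
  /- ─── RH-free inputs in explicit form (before naming) ─── -/
  obtain ⟨v, hvW, hvT, hvm, hvb, hvs, hvN, hvD, hclose⟩ := exists_smoothedResidual (a := a) hσ
    (primeShiftForm a ((Icc (-a) a).indicator (fun y ↦ Real.cosh (y / 2))) / (a + Real.sinh a))
  have hRW₀ : primeShiftForm a ((Icc (-a) a).indicator (fun y ↦ Real.cosh (y / 2))) / (a + Real.sinh a) ≤ W := by
    have h1 := primeShiftForm_le_weightSum_mul (a := a) hCm hCb hCs
    rw [integral_coshTest_sq ha0.le] at h1
    rw [div_le_iff₀ hP0']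
    exact h1.trans (mul_le_mul_of_nonneg_right hW hP0'.le)
  have hδ := fun y (hy : y ∈ Icc (-σ) σ) ↦
    integral_sq_residualTrunc_shift_sub_le (c := a - 2 * σ) ha hW hR0 hRW₀ (by linarith only [hσ1]) hy
  have hvr := hclose _ hδ
  have hGb := abs_residualCore_le a
    (primeShiftForm a ((Icc (-a) a).indicator (fun y ↦ Real.cosh (y / 2))) / (a + Real.sinh a))
  have hFsq := integral_primeShiftOp_sq_le (b' := a) hCm hCb hCs
  have hF2i := integrable_primeShiftOp_sq (b' := a) hCm hCb hCs
  have hFb0 := fun x ↦ abs_primeShiftOp_le (b' := a) hCb x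
  have hFm0 := measurable_primeShiftOp (b' := a) hCm
  have hC2 := integral_coshTest_sq ha0.le
  /- ─── names ─── -/
  set C : ℝ → ℝ := (Icc (-a) a).indicator (fun y ↦ Real.cosh (y / 2)) with hCdef
  set P := a + Real.sinh a with hP
  set R := primeShiftForm a C / P with hR
  set A := ∑ n ∈ weilPrimeIndex a, (Λ n : ℝ) / Real.sqrt n with hA
  set X := Real.exp a with hX
  set F : ℝ → ℝ := fun x ↦ ∑ n ∈ weilPrimeIndex a, (Λ n : ℝ) / Real.sqrt n * (C (x - Real.log n) + C (x + Real.log n))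
    with hFdef
  have hFx : ∀ x, F x = ∑ n ∈ weilPrimeIndex a, (Λ n : ℝ) / Real.sqrt n * (C (x - Real.log n) + C (x + Real.log n)) :=
    fun x ↦ rfl
  simp only [← hFx] at hvN hvD hvr hGb hFsq hF2i hFb0 ⊢
  set G : ℝ → ℝ := fun x ↦ F x - R * C x with hGdef
  have hGx : ∀ x, G x = F x - R * C x := fun x ↦ rfl
  simp only [← hGx] at hGb ⊢
  set c := a - 2 * σ with hc
  set r : ℝ → ℝ := (Icc (-c) c).indicator G with hrdef
  set ρ := ∫ x in Ioo (-a) a, G x ^ 2 with hρ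
  set M₀ := (2 * A + |R|) * Real.cosh (a / 2) with hM₀
  /- ─── basic facts ─── -/
  have hP0 : 0 < P := hP0'
  have hA0 : 0 ≤ A := Finset.sum_nonneg fun n _ ↦ div_nonneg ArithmeticFunction.vonMangoldt_nonneg (Real.sqrt_nonneg _)
  have hAW : 2 * A ≤ W := by rw [hA, Finset.mul_sum]; exact hW
  have hW0 : 0 ≤ W := by linarith only [hAW, hA0]
  have hRW : R ≤ W := hRW₀
  have hcosh : Real.cosh (a / 2) ^ 2 ≤ X := by
    have h1 : Real.cosh (a / 2) ≤ Real.exp (a / 2) := by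
      rw [Real.cosh_eq]
      have : Real.exp (-(a / 2)) ≤ Real.exp (a / 2) := Real.exp_le_exp.2 (by linarith only [ha0])
      linarith only [this]
    have h2 : Real.exp (a / 2) ^ 2 = Real.exp a := by rw [sq, ← Real.exp_add]; ring_nf
    rw [hX, ← h2]
    exact pow_le_pow_left₀ (Real.cosh_pos _).le h1 2
  have hFm : Measurable F := hFm0
  have hFb : ∀ x, |F x| ≤ 2 * A * Real.cosh (a / 2) := hFb0
  have hGm : Measurable G := hFm.sub (hCm.const_mul R)
  have hM₀0 : 0 ≤ M₀ := (abs_nonneg _).trans (hGb 0)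
  have hM₀W : M₀ ≤ 2 * W * Real.cosh (a / 2) := by
    rw [hM₀, abs_of_nonneg hR0]; exact mul_le_mul_of_nonneg_right (by linarith only [hAW, hRW]) (Real.cosh_pos _).le
  have hc0 : 0 < c := by rw [hc]; linarith only [ha, hσ1]
  have hIcc : Icc (-c) c ⊆ Ioo (-a) a := fun x hx ↦
    ⟨by rw [hc] at hx; linarith only [hx.1, hσ], by rw [hc] at hx; linarith only [hx.2, hσ]⟩
  -- `r` and `v − r` are admissible on `[−a, a]`
  have hrm : Measurable r := hGm.indicator measurableSet_Icc
  have hrb : ∀ x, |r x| ≤ M₀ := fun x ↦ by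
    by_cases hx : x ∈ Icc (-c) c
    · rw [hrdef, indicator_of_mem hx]; exact hGb x
    · rw [hrdef, indicator_of_notMem hx, abs_zero]; exact hM₀0
  have hrs : ∀ x, x ∉ Icc (-a) a → r x = 0 := fun x hx ↦
    indicator_of_notMem (fun h ↦ hx (Ioo_subset_Icc_self (hIcc h))) _
  have hdm : Measurable (fun x ↦ v x - r x) := hvm.sub hrm
  have hdb : ∀ x, |v x - r x| ≤ M₀ + M₀ := fun x ↦ (abs_sub _ _).trans (add_le_add (hvb x) (hrb x))
  have hds : ∀ x, x ∉ Icc (-a) a → v x - r x = 0 := fun x hx ↦ by rw [hvs x hx, hrs x hx, sub_zero]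
  have idd : Integrable fun x ↦ (v x - r x) ^ 2 := integrable_sq_admissible hdm hdb hds
  have hvr' : ∫ x, (v x - r x) ^ 2 ≤ 224 * W ^ 2 * X * σ := by linarith only [hvr]
  /- ─── window integrals ─── -/
  have hvol : volume (Ioo (-a) a) < ⊤ := measure_Ioo_lt_top
  have hint : ∀ {g : ℝ → ℝ} {M : ℝ}, Measurable g → (∀ x, |g x| ≤ M) → ∀ {S : Set ℝ}, volume S < ⊤ →
      IntegrableOn g S := by
    intro g M hg hM S hS
    exact Measure.integrableOn_of_bounded (M := M) hS.ne hg.aestronglyMeasurable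
      (Eventually.of_forall fun x ↦ by rw [Real.norm_eq_abs]; exact hM x)
  have hCG : ∀ x, |C x * G x| ≤ Real.cosh (a / 2) * M₀ := fun x ↦ by
    rw [abs_mul]; exact mul_le_mul (hCb x) (hGb x) (abs_nonneg _) (Real.cosh_pos _).le
  have hFG : ∀ x, |F x * G x| ≤ 2 * A * Real.cosh (a / 2) * M₀ := fun x ↦ by
    rw [abs_mul]; exact mul_le_mul (hFb x) (hGb x) (abs_nonneg _) (by positivity)
  have hGG : ∀ x, |G x ^ 2| ≤ M₀ ^ 2 := fun x ↦ by rw [abs_pow]; exact pow_le_pow_left₀ (abs_nonneg _) (hGb x) 2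
  have hCF : ∀ x, |C x * F x| ≤ Real.cosh (a / 2) * (2 * A * Real.cosh (a / 2)) := fun x ↦ by
    rw [abs_mul]; exact mul_le_mul (hCb x) (hFb x) (abs_nonneg _) (Real.cosh_pos _).le
  have hCC : ∀ x, |C x * C x| ≤ Real.cosh (a / 2) * Real.cosh (a / 2) := fun x ↦ by
    rw [abs_mul]; exact mul_le_mul (hCb x) (hCb x) (abs_nonneg _) (Real.cosh_pos _).le
  have iCG : IntegrableOn (fun x ↦ C x * G x) (Ioo (-a) a) := hint (hCm.mul hGm) hCG hvol
  have iFG : IntegrableOn (fun x ↦ F x * G x) (Ioo (-a) a) := hint (hFm.mul hGm) hFG hvol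
  have iGG : IntegrableOn (fun x ↦ G x ^ 2) (Ioo (-a) a) := hint (hGm.pow_const 2) hGG hvol
  have iCF : IntegrableOn (fun x ↦ C x * F x) (Ioo (-a) a) := hint (hCm.mul hFm) hCF hvol
  have iCC : IntegrableOn (fun x ↦ C x * C x) (Ioo (-a) a) := hint (hCm.mul hCm) hCC hvol
  have hIccw : ∀ g : ℝ → ℝ, ∫ x in Ioo (-a) a, C x * g x = ∫ x, C x * g x := fun g ↦ by
    rw [setIntegral_congr_set Ioo_ae_eq_Icc]
    exact setIntegral_eq_integral_of_forall_compl_eq_zero fun x hx ↦ by rw [hCs x hx, zero_mul]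
  have hQF : ∫ x, C x * F x = R * P := by
    have h := bilinear_eq_integral_primeShiftOp_mul (b := a) hCm hCm hCb hCb hCs
    have e : ∑ n ∈ weilPrimeIndex a, 2 * ((Λ n : ℝ) / Real.sqrt n) *
        ((∫ x, C (x - Real.log n) * C x) + ∫ x, C (x - Real.log n) * C x) = 2 * primeShiftForm a C := by
      unfold primeShiftForm; rw [Finset.mul_sum]; exact Finset.sum_congr rfl fun n _ ↦ by ring
    rw [e] at h
    have h2 : ∫ x, C x * F x = ∫ x, F x * C x := integral_congr_ae (Eventually.of_forall fun x ↦ mul_comm _ _)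
    rw [h2, hR, div_mul_cancel₀ _ hP0.ne']
    simp only [hFdef] at h ⊢; linarith only [h]
  have hCC' : ∫ x, C x * C x = P := by
    rw [← hC2]; exact integral_congr_ae (Eventually.of_forall fun x ↦ by ring)
  have horth : ∫ x in Ioo (-a) a, C x * G x = 0 := by
    have e : (fun x ↦ C x * G x) = fun x ↦ C x * F x - R * (C x * C x) := funext fun x ↦ by simp only [hGdef]; ring
    rw [e, integral_sub iCF (iCC.const_mul R), integral_const_mul, hIccw F, hIccw C, hQF, hCC']; ring
  have hFGρ : ∫ x in Ioo (-a) a, F x * G x = ρ := by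
    have e : (fun x ↦ F x * G x) = fun x ↦ G x ^ 2 + R * (C x * G x) := funext fun x ↦ by simp only [hGdef]; ring
    rw [e, integral_add iGG (iCG.const_mul R), integral_const_mul, horth, mul_zero, add_zero]
  /- ─── the collar `(−a, a) ∖ [−c, c]` of width `4σ` ─── -/
  have hcollar : volume.real (Ioo (-a) a \ Icc (-c) c) = 4 * σ := by
    rw [measureReal_sdiff hIcc measurableSet_Icc, Real.volume_real_Ioo_of_le (by linarith only [ha]),
      Real.volume_real_Icc_of_le (by linarith only [hc0]), hc]; ring
  have hvolD : volume (Ioo (-a) a \ Icc (-c) c) < ⊤ := lt_of_le_of_lt (measure_mono sdiff_subset) hvol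
  have hCr : ∫ x, C x * r x = -∫ x in Ioo (-a) a \ Icc (-c) c, C x * G x := by
    have e1 : (fun x ↦ C x * r x) = (Icc (-c) c).indicator (fun x ↦ C x * G x) := by
      funext x; simp only [hrdef]; exact (indicator_mul_right _ _ _).symm
    rw [e1, integral_indicator measurableSet_Icc, setIntegral_sdiff measurableSet_Icc iCG hIcc, horth]; ring
  have hFr : ∫ x, F x * r x = ρ - ∫ x in Ioo (-a) a \ Icc (-c) c, F x * G x := by
    have e1 : (fun x ↦ F x * r x) = (Icc (-c) c).indicator (fun x ↦ F x * G x) := by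
      funext x; simp only [hrdef]; exact (indicator_mul_right _ _ _).symm
    rw [e1, integral_indicator measurableSet_Icc, setIntegral_sdiff measurableSet_Icc iFG hIcc, hFGρ]; ring
  have hbdC : |∫ x in Ioo (-a) a \ Icc (-c) c, C x * G x| ≤ 8 * W * X * σ := by
    have h1 := norm_setIntegral_le_of_norm_le_const hvolD (f := fun x ↦ C x * G x)
      (fun x _ ↦ show ‖C x * G x‖ ≤ Real.cosh (a / 2) * M₀ by rw [Real.norm_eq_abs]; exact hCG x)
    rw [Real.norm_eq_abs, hcollar] at h1
    have h2 : Real.cosh (a / 2) * M₀ ≤ 2 * W * X :=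
      calc Real.cosh (a / 2) * M₀ ≤ Real.cosh (a / 2) * (2 * W * Real.cosh (a / 2)) :=
            mul_le_mul_of_nonneg_left hM₀W (Real.cosh_pos (a / 2)).le
        _ = 2 * W * Real.cosh (a / 2) ^ 2 := by ring
        _ ≤ 2 * W * X := mul_le_mul_of_nonneg_left hcosh (by positivity)
    have h4 : Real.cosh (a / 2) * M₀ * (4 * σ) ≤ 2 * W * X * (4 * σ) := mul_le_mul_of_nonneg_right h2 (by linarith only [hσ])
    linarith only [h1, h4]
  have hbdF : |∫ x in Ioo (-a) a \ Icc (-c) c, F x * G x| ≤ 8 * W ^ 2 * X * σ := by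
    have h1 := norm_setIntegral_le_of_norm_le_const hvolD (f := fun x ↦ F x * G x)
      (fun x _ ↦ show ‖F x * G x‖ ≤ 2 * A * Real.cosh (a / 2) * M₀ by rw [Real.norm_eq_abs]; exact hFG x)
    rw [Real.norm_eq_abs, hcollar] at h1
    have h2 : 2 * A * Real.cosh (a / 2) * M₀ ≤ 2 * W ^ 2 * X :=
      calc 2 * A * Real.cosh (a / 2) * M₀ ≤ 2 * A * Real.cosh (a / 2) * (2 * W * Real.cosh (a / 2)) :=
            mul_le_mul_of_nonneg_left hM₀W (by positivity)
        _ = (2 * A) * (2 * W * Real.cosh (a / 2) ^ 2) := by ring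
        _ ≤ W * (2 * W * X) :=
            mul_le_mul hAW (mul_le_mul_of_nonneg_left hcosh (by positivity)) (by positivity) hW0
        _ = 2 * W ^ 2 * X := by ring
    have h4 : 2 * A * Real.cosh (a / 2) * M₀ * (4 * σ) ≤ 2 * W ^ 2 * X * (4 * σ) :=
      mul_le_mul_of_nonneg_right h2 (by linarith only [hσ])
    linarith only [h1, h4]
  /- ─── whole-line integrability and the splits `v = (v − r) + r` ─── -/
  have iCv : Integrable fun x ↦ C x * (v x - r x) := integrable_mul_admissible hCm hCb hdm hdb hds
  have iCr : Integrable fun x ↦ C x * r x := integrable_mul_admissible hCm hCb hrm hrb hrs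
  have iFv : Integrable fun x ↦ F x * (v x - r x) := integrable_mul_admissible hFm hFb hdm hdb hds
  have iFr : Integrable fun x ↦ F x * r x := integrable_mul_admissible hFm hFb hrm hrb hrs
  have iC2 : Integrable fun x ↦ C x ^ 2 := integrable_sq_admissible hCm hCb hCs
  have hC2' : ∫ x, C x ^ 2 = P := hC2
  /- (1) `∫ r² ≤ ρ`, hence `∫ v² ≤ ρ` -/
  have hr2 : ∫ x, r x ^ 2 ≤ ρ := by
    have e : (fun x ↦ r x ^ 2) = (Icc (-c) c).indicator (fun x ↦ G x ^ 2) := by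
      funext x; by_cases hx : x ∈ Icc (-c) c
      · simp only [hrdef, indicator_of_mem hx]
      · simp only [hrdef, indicator_of_notMem hx, ne_eq, OfNat.ofNat_ne_zero, not_false_eq_true, zero_pow]
    rw [e, integral_indicator measurableSet_Icc]
    exact setIntegral_mono_set iGG (Eventually.of_forall fun x ↦ sq_nonneg (G x))
      (Eventually.of_forall fun x hx ↦ hIcc hx)
  have hvρ : ∫ x, v x ^ 2 ≤ ρ := hvN.trans hr2
  /- (2) the coupling with `C` -/
  have hEC : |∫ x, C x * v x| ≤ 8 * W * X * σ + (θ * P + 224 * W ^ 2 * X * σ / θ) / 2 := by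
    have e : ∫ x, C x * v x = (∫ x, C x * (v x - r x)) + ∫ x, C x * r x := by
      rw [← integral_add iCv iCr]; exact integral_congr_ae (Eventually.of_forall fun x ↦ by ring)
    have h1 := abs_integral_mul_le_amgm iCv iC2 idd hθ
    rw [hC2'] at h1
    have h2 : (θ * P + (∫ x, (v x - r x) ^ 2) / θ) / 2 ≤ (θ * P + 224 * W ^ 2 * X * σ / θ) / 2 := by
      have := div_le_div_of_nonneg_right hvr' hθ.le
      linarith only [this]
    rw [e]
    calc |(∫ x, C x * (v x - r x)) + ∫ x, C x * r x|
        ≤ |∫ x, C x * (v x - r x)| + |∫ x, C x * r x| := abs_add_le _ _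
      _ ≤ (θ * P + 224 * W ^ 2 * X * σ / θ) / 2 + 8 * W * X * σ :=
          add_le_add (h1.trans h2) (by rw [hCr, abs_neg]; exact hbdC)
      _ = _ := by ring
  /- (3) the coupling with `F` -/
  have hEF : |(∫ x, F x * v x) - ρ| ≤ 8 * W ^ 2 * X * σ + (θ' * (W ^ 2 * P) + 224 * W ^ 2 * X * σ / θ') / 2 := by
    have e : (∫ x, F x * v x) - ρ = (∫ x, F x * (v x - r x)) - ∫ x in Ioo (-a) a \ Icc (-c) c, F x * G x := by
      have h : ∫ x, F x * v x = (∫ x, F x * (v x - r x)) + ∫ x, F x * r x := by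
        rw [← integral_add iFv iFr]; exact integral_congr_ae (Eventually.of_forall fun x ↦ by ring)
      rw [h, hFr]; ring
    have h1 := abs_integral_mul_le_amgm iFv hF2i idd hθ'
    have hF2 : ∫ x, F x ^ 2 ≤ W ^ 2 * P := by
      refine hFsq.trans ?_
      rw [hC2']
      have h4 : 4 * A ^ 2 ≤ W ^ 2 :=
        calc 4 * A ^ 2 = (2 * A) ^ 2 := by ring
          _ ≤ W ^ 2 := pow_le_pow_left₀ (by positivity) hAW 2
      exact mul_le_mul_of_nonneg_right h4 hP0.le
    have h2 : (θ' * (∫ x, F x ^ 2) + (∫ x, (v x - r x) ^ 2) / θ') / 2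
        ≤ (θ' * (W ^ 2 * P) + 224 * W ^ 2 * X * σ / θ') / 2 := by
      have h5 := mul_le_mul_of_nonneg_left hF2 hθ'.le
      have h6 := div_le_div_of_nonneg_right hvr' hθ'.le
      linarith only [h5, h6]
    rw [e]
    calc |(∫ x, F x * (v x - r x)) - ∫ x in Ioo (-a) a \ Icc (-c) c, F x * G x|
        ≤ |∫ x, F x * (v x - r x)| + |∫ x in Ioo (-a) a \ Icc (-c) c, F x * G x| := abs_sub _ _
      _ ≤ (θ' * (W ^ 2 * P) + 224 * W ^ 2 * X * σ / θ') / 2 + 8 * W ^ 2 * X * σ := add_le_add (h1.trans h2) hbdF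
      _ = _ := by ring
  /- (4) the `sinh` moment: `∫ r·sinh(·/2) = 0` by evenness -/
  have hr0 : ∫ x, r x * Real.sinh (x / 2) = 0 :=
    integral_mul_sinh_half_eq_zero_of_even fun x ↦ residual_neg a c R x
  set sh : ℝ → ℝ := (Icc (-a) a).indicator (fun x ↦ Real.sinh (x / 2)) with hsh
  have hsc : ∀ x : ℝ, |Real.sinh x| ≤ Real.cosh x := fun x ↦ abs_le.2
    ⟨by have h := Real.sinh_lt_cosh (-x); rw [Real.sinh_neg, Real.cosh_neg] at h; linarith only [h], (Real.sinh_lt_cosh x).le⟩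
  have hshm : Measurable sh :=
    (Real.continuous_sinh.measurable.comp (measurable_id.div_const 2)).indicator measurableSet_Icc
  have hshb : ∀ x, |sh x| ≤ Real.cosh (a / 2) := fun x ↦ by
    by_cases hx : x ∈ Icc (-a) a
    · rw [hsh, indicator_of_mem hx]
      refine (hsc _).trans ?_
      rw [Real.cosh_le_cosh, abs_div, abs_div, abs_two]
      exact div_le_div_of_nonneg_right ((abs_le.2 ⟨hx.1, hx.2⟩).trans (le_abs_self a)) two_pos.le
    · rw [hsh, indicator_of_notMem hx, abs_zero]; exact (Real.cosh_pos _).le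
  have hshs : ∀ x, x ∉ Icc (-a) a → sh x = 0 := fun x hx ↦ indicator_of_notMem hx _
  have iSh2 : Integrable fun x ↦ sh x ^ 2 := integrable_sq_admissible hshm hshb hshs
  have iShd : Integrable fun x ↦ sh x * (v x - r x) := integrable_mul_admissible hshm hshb hdm hdb hds
  have iShr : Integrable fun x ↦ sh x * r x := integrable_mul_admissible hshm hshb hrm hrb hrs
  have hsh_eq : ∀ g : ℝ → ℝ, (∀ x, x ∉ Icc (-a) a → g x = 0) → ∀ x, g x * Real.sinh (x / 2) = sh x * g x := by
    intro g hg x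
    by_cases hx : x ∈ Icc (-a) a
    · rw [hsh, indicator_of_mem hx, mul_comm]
    · rw [hg x hx, hsh, indicator_of_notMem hx, zero_mul, zero_mul]
  have hsh2 : ∫ x, sh x ^ 2 ≤ P := by
    rw [← hC2']
    refine integral_mono_of_nonneg (Eventually.of_forall fun x ↦ sq_nonneg _) iC2 (Eventually.of_forall fun x ↦ ?_)
    by_cases hx : x ∈ Icc (-a) a
    · simp only [hsh, hCdef, indicator_of_mem hx]; linarith only [Real.cosh_sq (x / 2)]
    · simp only [hsh, hCdef, indicator_of_notMem hx]; exact le_rfl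
  have hS : |∫ t, v t * Real.sinh (t / 2)| ≤ (θ * P + 224 * W ^ 2 * X * σ / θ) / 2 := by
    have iVs : Integrable fun t ↦ (v t - r t) * Real.sinh (t / 2) :=
      iShd.congr (Eventually.of_forall fun x ↦ (hsh_eq _ hds x).symm)
    have iRs : Integrable fun t ↦ r t * Real.sinh (t / 2) :=
      iShr.congr (Eventually.of_forall fun x ↦ (hsh_eq _ hrs x).symm)
    have e : ∫ t, v t * Real.sinh (t / 2) = ∫ x, sh x * (v x - r x) := by
      have e1 : ∫ t, v t * Real.sinh (t / 2) = (∫ t, (v t - r t) * Real.sinh (t / 2)) + ∫ t, r t * Real.sinh (t / 2) := by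
        rw [← integral_add iVs iRs]; exact integral_congr_ae (Eventually.of_forall fun x ↦ by ring)
      rw [e1, hr0, add_zero]
      exact integral_congr_ae (Eventually.of_forall fun x ↦ hsh_eq _ hds x)
    rw [e]
    refine (abs_integral_mul_le_amgm iShd iSh2 idd hθ).trans ?_
    have h5 := mul_le_mul_of_nonneg_left hsh2 hθ.le
    have h6 := div_le_div_of_nonneg_right hvr' hθ.le
    linarith only [h5, h6]
  /- (5), (6) quadratic moduli -/
  have hmodr : ∀ h : ℝ, 0 < h → h ≤ 2 * σ → ∫ x, (v (x + h) - v x) ^ 2 ≤ ρ / σ ^ 2 * h ^ 2 := by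
    intro h hh0 hh2
    refine (hvD h hh0 hh2).trans ?_
    have h1 : (h / σ) ^ 2 * ∫ x, r x ^ 2 ≤ (h / σ) ^ 2 * ρ := mul_le_mul_of_nonneg_left hr2 (sq_nonneg _)
    refine h1.trans (le_of_eq ?_)
    field_simp
  have hmod : ∀ h : ℝ, 0 < h → h ≤ min (2 * σ) 1 →
      ∫ x, ‖((v (x + h) : ℝ) : ℂ) - ((v x : ℝ) : ℂ)‖ ^ 2 ≤ ρ / σ ^ 2 * h ^ 2 := by
    intro h hh0 hh1
    have e : ∫ x, ‖((v (x + h) : ℝ) : ℂ) - ((v x : ℝ) : ℂ)‖ ^ 2 = ∫ x, (v (x + h) - v x) ^ 2 :=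
      integral_congr_ae (Eventually.of_forall fun x ↦ by
        simp only [← Complex.ofReal_sub, Complex.norm_real, Real.norm_eq_abs, sq_abs])
    rw [e]; exact hmodr h hh0 (hh1.trans (min_le_left _ _))
  have hmodx : ∀ h : ℝ, 0 < h → h ≤ min (2 * σ) 1 →
      ∫ x, ‖((x + h : ℝ) : ℂ) * ((v (x + h) : ℝ) : ℂ) - (x : ℂ) * ((v x : ℝ) : ℂ)‖ ^ 2
        ≤ (2 * (a + 1) ^ 2 * (ρ / σ ^ 2) + 2 * ρ) * h ^ 2 := by
    intro h hh0 hh1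
    have h1 := integral_sq_shift_sub_mul_x_le (a := a) hvm hvb hvs hh0 (hh1.trans (min_le_right _ _))
    have h2 := hmodr h hh0 (hh1.trans (min_le_left _ _))
    have h5 : 2 * (a + 1) ^ 2 * ∫ x, (v (x + h) - v x) ^ 2 ≤ 2 * (a + 1) ^ 2 * (ρ / σ ^ 2 * h ^ 2) :=
      mul_le_mul_of_nonneg_left h2 (by positivity)
    have h6 : 2 * h ^ 2 * ∫ x, v x ^ 2 ≤ 2 * h ^ 2 * ρ := mul_le_mul_of_nonneg_left hvρ (by positivity)
    calc _ ≤ _ := h1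
      _ ≤ 2 * (a + 1) ^ 2 * (ρ / σ ^ 2 * h ^ 2) + 2 * h ^ 2 * ρ := add_le_add h5 h6
      _ = (2 * (a + 1) ^ 2 * (ρ / σ ^ 2) + 2 * ρ) * h ^ 2 := by ring
  /- (7) the second moment -/
  have hx2 : ∫ x, x ^ 2 * v x ^ 2 ≤ a ^ 2 * ∫ x, v x ^ 2 := by
    rw [← integral_const_mul]
    refine integral_mono_of_nonneg (Eventually.of_forall fun x ↦ by positivity)
      ((integrable_sq_admissible hvm hvb hvs).const_mul _) (Eventually.of_forall fun x ↦ ?_)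
    by_cases hx : x ∈ Icc (-a) a
    · exact mul_le_mul_of_nonneg_right (sq_le_sq' hx.1 hx.2) (sq_nonneg _)
    · show x ^ 2 * v x ^ 2 ≤ a ^ 2 * v x ^ 2
      rw [hvs x hx]; simp
  exact ⟨v, hvW, hvT, hvρ, hEC, hEF, hS, hmod, hmodx, hx2⟩

end FloorSecondOrder

end Summit.RiemannHypothesis.RiemannHypothesis.Theorems.WeilFormatC
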